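import Summits.QuantumFields.YangMills.Theorems.BalabanUVNodesN12RootedForest
import Summits.QuantumFields.YangMills.Theorems.BalabanUVNodesN12BlockChains
import Summits.QuantumFields.YangMills.Theorems.BalabanUVNodesN21ReadSetSupport
import HarnessLib

/-!
# BalabanUVNodes ∕ N12 — THE TOWER-SITE CONSTRAINT GRAPH OF `𝐁_k(Z) = Bj M₁ Z k` IS CONNECTED, PART 1 (PRELIMINARIES): levels of fine sites, the block bookkeeping of one
# lattice step, the printed collar, and the `Γ_ℓ`-sites of the outer `(ℓ+1)`-block (the 400-line split of `…N12TowerSiteGraphConnectedBj`, which proves the connectivity from these)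

[Balaban1988Convergent] = «[III]», (2.2) p. 255 (the determining set `𝐁 = {Γ_j}`, `Γ₀ = Ω₁ᶜ`, `Γ_j = Ω_j^{(j)} ∖ Ω_{j+1}^{(j)}`, `Γ_k = Ω_k^{(k)}`), (2.13)
pp. 256–257 (the maximal sequence `Ω = Ω₀ ⊃ Ω₁ ⊃ … ⊃ Ω_k`: `Ω_n` a union of `LⁿξM₁`-cubes, `dist(Ω_n, Ωᶜ_{n−1}) ≥ LⁿξM₁`); [Balaban1987RG1] (0.1)–(0.3)
pp. 251–252 (the block lattices `T^{(j)}`, blocks and centres); [Balaban1985Variational] = «[15]», Thm 1 p. 279 («a unique critical orbit in the space (6)»), (3)–(4) p. 278.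

Cell `pub-ymgap` (HUMAN RULINGS D-0062 ∕ D-0149), WIDTH SEAT `pub-ymgap-dag-n12-w6` g17 (node N12 = [B15]; key K1⁹ `stmt-QuantumFields-27364`, `--kind proof --supports … --as helper`;
count-neutral).  THEOREMS ONLY (0 `def`, 0 `instance`, 0 `sorry`).  Pure lattice combinatorics over landed kernel theorems, consumed BY NAME: r11∕r12's `B14.Eq213DetSet`
(`Bj`, `maxDomT`, `Bj_zero`∕`Bj_mid`∕`Bj_top`, `isBlockUnion_maxDomT(_succ)`, the printed collar `dist_maxDomT`, `maxDomT_antitone`), dag-n12-w3's `N12FlatHndRecordLetters.hcov_Bj` (every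
fine site has a level), `N12RootedForest.exists_word_walkEnd_eq` (the fine torus is connected) and `N12BlockChains.blockOf_shift_or` ∕ `exists_blockWalk` (a lattice path inside one
block), dag-n21-e's `N21ReadSetSupport` (`within_lift_of_blockIter_eq`, `blockIter_embIter`, `within_add_single`, `eq_of_shift_eq`).

WHY (numbers, not adjectives).  The (J0′) producer OF RECORD at N12 (dag-n12-c g26 V4 `…N12MinimiserFamilyOfClassThreshold.hMin_atRecord_of_node00Letters_thm1AtBase_central_ofClass_threshold`,
:173–:176) displays per base field `V_k` the row (T1@q₀)-CENTRAL: every constrained `U ∈ reg′` with no larger action is `U₀^{u⁻¹}` for a gauge transformation `u` whose tower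
restrictions are EQUAL and CENTRAL at the two tower sites `ι_j c₋`, `ι_j c₊` of every constrained bond `c ∈ bondsOf (𝐁_k(Z) j)`, `j ≤ k`.  dag-n12-w1 g4 LOCATED (memo
`LOCATED-3-T1-CENTRAL-AT-REDUCIBLE-DATA.md`; kernel: `N12Thm1CentralLetterTwistObstruction.not_T1central_flat_of_disconnected`, p645205) that at the FLAT base field `V_k ≡ 1` — a
member of every closed plaquette guard `{∀ p, |V_k(∂p) − 1| ≤ eR}` the knit quantifies over — this row is FALSE as soon as the TOWER-SITE CONSTRAINT GRAPH 𝒢 of the determining set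
(vertices = the fine sites `ι_j c₋`, `ι_j c₊` of the constrained bonds, edges = the constrained bonds) is DISCONNECTED: a set `T` of fine sites closed under the constrained bonds (`hT`)
containing one tower site (`hz₁`) and missing another (`hz₂`) twists `1` into a datum-preserving, action-preserving configuration outside the central orbit.  The referee's WATCH on that
file (ref-B READ-891) and w1's HANDOFF trigger (t6) record the companion positive lemma «𝒢 connected at the record» as UNOWNED.  THIS FILE PROVES IT for every domain `Z ⊂ T_η`, every
`1 ≤ k ≤ m + K`, every `M₁ ≥ 2` with the standing divisibility `LᵏM₁ ∣ 2L^{m+K}`: §3 `towerSite_mem_of_closed_Bj` is, BY SHAPE, the negation of the disconnection data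
`(hT, hz₁, hz₂)` of `not_T1central_flat_of_disconnected` at `𝔹 := Bj M₁ Z k`; `not_disconnected_towerSiteGraph_Bj` says the obstruction's premise set is EMPTY at the record.

THE PROOF (gluing of the levels along `∂Ω_j`, [III] (2.2)∕(2.13)).  Every fine site `x` has a LEVEL `ℓ ≤ k` — the scale whose member `Γ_ℓ` contains the `ℓ`-block of `x`
(dag-n12-w3's coverage letter `hcov_Bj`; unique, §1) — and a TOWER PROJECTION `τ x := ι_ℓ B^ℓ(x)`, a tower site.  For `T` closed under the constrained bonds the predicate `τ x ∈ T` is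
invariant along EVERY fine bond `⟨x, x + e_μ⟩` (§2): the two levels differ by at most one (the printed collar `dist(Ω_{n+1}, Ω_nᶜ) ≥ L^{n+1}M₁ > 1`); at equal levels the two
`ℓ`-blocks are equal or adjacent, and adjacent `Γ_ℓ`-blocks span a constrained bond; at levels `ℓ`, `ℓ+1` the `(ℓ+1)`-block `w` of the shallower site is NOT in `Ω_{ℓ+1}` but adjacent
to the `(ℓ+1)`-block of the deeper one, which is a `Γ_{ℓ+1}`-site — so `⟨w, ·⟩` is a constrained `(ℓ+1)`-bond whose outer tower site `ι_{ℓ+1} w = ι_ℓ (centre of w)` is a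
level-`ℓ` tower site, and ALL `ℓ`-sites of the block `w` lie in `Γ_ℓ` (off `Ω_{ℓ+1}` because `w` is; inside `Ω_ℓ` by the collar, `M₁ ≥ 2`), so the centre of `w` and `B^ℓ(x)` are
joined INSIDE `w` by constrained `ℓ`-bonds (w3's `exists_blockWalk`).  The fine torus is connected (w3's `exists_word_walkEnd_eq`), so `τ x ∈ T` is constant in `x`; a tower site
`ι_j c₋` with `c₋ ∈ Γ_j` is its own projection, and one with `c₊ ∈ Γ_j` is `T`-equivalent to `ι_j c₊` by closedness — whence §3.

CONTENTS OF THIS PART (namespace `Summit.QuantumFields.YangMills.BalabanUVNodes.N12TowerSiteGraphConnectedBjPrelim`; generic `P : Params`, any `Z ⊂ T_η`): `level_zero_iff`,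
`mem_maxDomT_of_level`, `not_mem_maxDomT_succ_of_level`, `exists_level` (w3's (Cov) in r12's `blockIter` currency), `level_unique`, `blockIter_shift_or`, `cover_lift_add_single` ∕
`cover_lift_sub_single`, `levels_near_of_shift` (the collar: adjacent fine sites have levels at most one apart), ★ `mem_Bj_of_blockOf_eq_outerBlock` (every `ℓ`-site of the outer
`(ℓ+1)`-block is a `Γ_ℓ`-site), ★ `embIter_mem_iff_of_outerBlock` (they are `T`-equivalent for every `T` closed under the constrained bonds, by w3's walk inside the block).  PART 2
(`…N12TowerSiteGraphConnectedBj`): the `T`-invariance of the tower projection along every fine bond, its constancy on the torus, and ★★★ `towerSite_mem_of_closed_Bj` ∕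
`not_disconnected_towerSiteGraph_Bj`.

HONEST FRAMING.  A located PRECONDITION of a displayed hypothesis-letter is discharged — NOT the letter: with 𝒢 connected, (T1@q₀)-central at the flat base field still asks that every
flat fibre configuration with the unit multi-scale datum on `𝐁_k(Z)` be tower-central-gauge-trivial (print's [15] Thm 1 uniqueness at that datum; not typed here).  Count-neutral
helper; nothing of Bałaban's estimates asserted or refuted; N12 NOT discharged; K1⁹ NOT closed; counts of record unmoved; one finite 𝕋⁴ programme at fixed ε — R4 closes the conditional
rung `BalabanLadder.UV` only; the Yang–Mills mass gap (Clay) is NOT proved by any of this; nothing continuum ∕ ℝ⁴ ∕ OS.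
-/

namespace Summit.QuantumFields.YangMills.BalabanUVNodes.N12TowerSiteGraphConnectedBjPrelim

open Set
open Literature.MathematicalPhysics.QuantumFieldTheory.Balaban1983to89
open B15DeterminingSets (DetSet pts mem_pts bondsOf embIter)
open B14.Eq213DetSet (Bj maxDomT Bj_zero Bj_mid Bj_top maxDomT_antitone isBlockUnion_maxDomT isBlockUnion_maxDomT_succ dist_maxDomT)
open B14.Eq213MaximalDomains (side)
open B14.Eq22Determines (blockIter blockIter_zero blockIter_succ IsBlockUnion)
open B15Eq112TorusCover (cover lift cover_lift)
open B14DomainGeom (Within Pt)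
open T4Continuum (walkEnd)
open Summit.QuantumFields.YangMills.BalabanUVNodes.N12FlatHndRecordLetters (hcov_Bj blockIter_eq_iterBlockOf)
open Summit.QuantumFields.YangMills.BalabanUVNodes.N12RootedForest (exists_word_walkEnd_eq)
open Summit.QuantumFields.YangMills.BalabanUVNodes.N12BlockChains (blockOf_shift_or exists_blockWalk)
open Summit.QuantumFields.YangMills.Theorems.N21ReadSetSupport (within_lift_of_blockIter_eq blockIter_embIter within_add_single within_sub_single eq_of_shift_eq)

variable {P : Params} {M₁ k : ℕ} {Z : Set (Site P 0)}

/-! ## §1  Levels of fine sites for `𝐁_k(Z)` and the block bookkeeping of one lattice step -/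

/-- `M₁ ≥ 2 ⇒ M₁ ≥ 1`. [folklore] -/
theorem one_le_of_two_le (hM : 2 ≤ M₁) : 1 ≤ M₁ := le_trans (by norm_num) hM

/-- The cube side `s_n = LⁿM₁` is at least `M₁`. [cite: Balaban1988Convergent, (2.13) pp.256–257 (bookkeeping)] -/
theorem le_side (n : ℕ) : M₁ ≤ side P.L M₁ n := by
  unfold side
  exact Nat.le_mul_of_pos_left M₁ (pow_pos P.L_pos n)

/-- The cube side `s_{n}` dominates `Lⁿ + 1` once `M₁ ≥ 2`. [cite: Balaban1988Convergent, (2.13) pp.256–257 (bookkeeping)] -/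
theorem pow_succ_le_side (hM : 2 ≤ M₁) (n : ℕ) : P.L ^ n + 1 ≤ side P.L M₁ n := by
  unfold side
  have h1 : 1 ≤ P.L ^ n := Nat.one_le_pow _ _ P.L_pos
  calc P.L ^ n + 1 ≤ P.L ^ n + P.L ^ n := by omega
    _ = P.L ^ n * 2 := by ring
    _ ≤ P.L ^ n * M₁ := Nat.mul_le_mul_left _ hM

/-- **LEVEL `0`**: the `0`-block of `x` (= `x`) is a `Γ₀`-site of `𝐁_k(Z)` iff `x ∉ Ω₁(Z)` (`Γ₀ = Ω₁ᶜ`, `k ≥ 1`). [cite: Balaban1988Convergent, (2.2) p.255] -/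
theorem level_zero_iff (hk1 : 1 ≤ k) (x : Site P 0) : blockIter 0 x ∈ Bj M₁ Z k 0 ↔ x ∉ maxDomT M₁ Z 1 := by
  rw [blockIter_zero, Bj_zero hk1]
  rfl

/-- **A POSITIVE LEVEL `j` PUTS `x` IN `Ω_j(Z)`**: if the `j`-block of `x` is a `Γ_j`-site (`1 ≤ j ≤ k`), then `x ∈ Ω_j(Z)` (`Γ_j ⊆ Ω_j^{(j)}` and `Ω_j` is a union of `j`-blocks).
[cite: Balaban1988Convergent, (2.2) p.255, (2.13) pp.256–257] -/
theorem mem_maxDomT_of_level (hM : 1 ≤ M₁) (hk : k ≤ P.m + P.K) (hdiv : side P.L M₁ k ∣ P.sitesPerDir 0)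
    {j : ℕ} (hj1 : 1 ≤ j) (hjk : j ≤ k) {x : Site P 0} (h : blockIter j x ∈ Bj M₁ Z k j) : x ∈ maxDomT M₁ Z j := by
  have hsub : Bj M₁ Z k j ⊆ pts j (maxDomT M₁ Z j) := by
    rcases lt_or_eq_of_le hjk with hlt | rfl
    · rw [Bj_mid hj1 hlt]; exact fun _ h => h.1
    · rw [Bj_top]
  exact (isBlockUnion_maxDomT hM hdiv hj1 hjk (hjk.trans hk) x).2 (mem_pts.1 (hsub h))

/-- **A LEVEL `j < k` KEEPS `x` OUT OF `Ω_{j+1}(Z)`**: if the `j`-block of `x` is a `Γ_j`-site (`j < k`), then `x ∉ Ω_{j+1}(Z)` (`Γ₀ = Ω₁ᶜ`; `Γ_j` misses `Ω_{j+1}^{(j)}` and `Ω_{j+1}`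
is a union of `j`-blocks). [cite: Balaban1988Convergent, (2.2) p.255, (2.13) pp.256–257] -/
theorem not_mem_maxDomT_succ_of_level (hM : 1 ≤ M₁) (hk : k ≤ P.m + P.K) (hdiv : side P.L M₁ k ∣ P.sitesPerDir 0)
    {j : ℕ} (hjk : j < k) {x : Site P 0} (h : blockIter j x ∈ Bj M₁ Z k j) : x ∉ maxDomT M₁ Z (j + 1) := by
  rcases Nat.eq_zero_or_pos j with rfl | hj1
  · exact (level_zero_iff (by omega) x).1 h
  · rw [Bj_mid hj1 hjk] at h
    intro hx
    exact h.2 (mem_pts.2 ((isBlockUnion_maxDomT_succ hM hdiv (Nat.succ_le_of_lt hjk) (by omega) x).1 hx))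

/-- **EVERY FINE SITE HAS A LEVEL** — dag-n12-w3's coverage letter (Cov) `N12FlatHndRecordLetters.hcov_Bj` in r12's `blockIter` currency: for `1 ≤ k ≤ m + K`, `1 ≤ M₁`,
`LᵏM₁ ∣ 2L^{m+K}`, some `j ≤ k` has the `j`-block of `x` in `Γ_j`. [cite: Balaban1988Convergent, (2.2) p.255, (2.13) pp.256–257] -/
theorem exists_level (hM : 1 ≤ M₁) (hk1 : 1 ≤ k) (hk : k ≤ P.m + P.K) (hdiv : side P.L M₁ k ∣ P.sitesPerDir 0) (x : Site P 0) :
    ∃ j, j ≤ k ∧ blockIter j x ∈ Bj M₁ Z k j := by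
  obtain ⟨j, hj, h⟩ := hcov_Bj (Z := Z) hM hk1 hk hdiv x
  exact ⟨j, hj, by rw [blockIter_eq_iterBlockOf]; exact h⟩

/-- **THE LEVEL IS UNIQUE**: two scales `j, j' ≤ k` whose members contain the blocks of one fine site coincide (the domains are nested: a level `j < k` keeps `x` out of `Ω_{j+1} ⊇ Ω_{j'}`
for every `j' > j`). [cite: Balaban1988Convergent, (2.2) p.255, (2.13) pp.256–257] -/
theorem level_unique (hM : 1 ≤ M₁) (hk : k ≤ P.m + P.K) (hdiv : side P.L M₁ k ∣ P.sitesPerDir 0) {x : Site P 0}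
    {j j' : ℕ} (hj : j ≤ k) (hj' : j' ≤ k) (h : blockIter j x ∈ Bj M₁ Z k j) (h' : blockIter j' x ∈ Bj M₁ Z k j') : j = j' := by
  -- the asymmetric core: a smaller level contradicts a larger one
  have key : ∀ {i i' : ℕ}, i ≤ k → i' ≤ k → blockIter i x ∈ Bj M₁ Z k i → blockIter i' x ∈ Bj M₁ Z k i' → ¬ i < i' := by
    intro i i' _ hi' hi hi'' hlt
    have h1 : x ∉ maxDomT M₁ Z (i + 1) := not_mem_maxDomT_succ_of_level hM hk hdiv (lt_of_lt_of_le hlt hi') hi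
    have h2 : x ∈ maxDomT M₁ Z i' := mem_maxDomT_of_level hM hk hdiv (by omega) hi' hi''
    exact h1 (maxDomT_antitone hM Z (Nat.succ_le_of_lt hlt) h2)
  rcases lt_trichotomy j j' with hlt | heq | hgt
  · exact absurd hlt (key hj hj' h h')
  · exact heq
  · exact absurd hgt (key hj' hj h' h)

/-- **THE `n`-BLOCKS OF `x` AND `x + e_μ` ARE EQUAL OR `μ`-ADJACENT** (`n ≤ m + K`; dag-n12-w3's one-level `blockOf_shift_or` iterated). [cite: Balaban1987RG1, (0.3) p.252 (bookkeeping)] -/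
theorem blockIter_shift_or {n : ℕ} (hn : n ≤ P.m + P.K) (x : Site P 0) (μ : Fin P.d) :
    blockIter n (x.shift μ) = blockIter n x ∨ blockIter n (x.shift μ) = (blockIter n x).shift μ := by
  induction n with
  | zero => exact Or.inr rfl
  | succ n ih =>
    rw [blockIter_succ, blockIter_succ]
    rcases ih (by omega) with h | h
    · exact Or.inl (by rw [h])
    · rw [h]
      exact blockOf_shift_or (by omega) (blockIter n x) μ

/-- The cover intertwines the unit translation at a standard lift: `π (lift x + e_μ) = x + e_μ`. [cite: Balaban1987RG1, (0.1) p.251 (the torus; bookkeeping)] -/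
theorem cover_lift_add_single (x : Site P 0) (μ : Fin P.d) : cover P (lift P x + Pi.single μ 1) = x.shift μ := by
  funext i
  rw [Site.shift_apply]
  by_cases h : i = μ
  · subst h
    simp [cover, lift, Int.cast_add]
  · simp [cover, lift, h]

/-- The cover point `lift (x + e_μ) − e_μ`… read backwards: `π (lift x' − e_μ) = x` when `x' = x + e_μ`. [cite: Balaban1987RG1, (0.1) p.251 (the torus; bookkeeping)] -/
theorem cover_lift_sub_single {x x' : Site P 0} {μ : Fin P.d} (h : x' = x.shift μ) : cover P (lift P x' - Pi.single μ 1) = x := by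
  subst h
  have e : cover P (lift P (x.shift μ) - Pi.single μ 1 + Pi.single μ 1) = (cover P (lift P (x.shift μ) - Pi.single μ 1)).shift μ :=
    B15Claim189CubePin.cover_add_single _ μ
  rw [sub_add_cancel, cover_lift] at e
  exact (eq_of_shift_eq e).symm

/-- **ADJACENT FINE SITES HAVE LEVELS AT MOST ONE APART** (the printed collar `dist(Ω_{n+1}, Ω_nᶜ) ≥ L^{n+1}M₁ > 1` of [III] (2.13), `M₁ ≥ 2`): if the `j`-block of `x` is a `Γ_j`-site and
the `j'`-block of `x + e_μ` a `Γ_{j'}`-site (`j, j' ≤ k`), then `j' ≤ j + 1` and `j ≤ j' + 1`. [cite: Balaban1988Convergent, (2.13) pp.256–257] -/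
theorem levels_near_of_shift (hM : 2 ≤ M₁) (hk : k ≤ P.m + P.K) (hdiv : side P.L M₁ k ∣ P.sitesPerDir 0)
    {x : Site P 0} {μ : Fin P.d} {j j' : ℕ} (hj : j ≤ k) (hj' : j' ≤ k)
    (h : blockIter j x ∈ Bj M₁ Z k j) (h' : blockIter j' (x.shift μ) ∈ Bj M₁ Z k j') : j' ≤ j + 1 ∧ j ≤ j' + 1 := by
  have hM1 : 1 ≤ M₁ := one_le_of_two_le hM
  have hw : Within 1 (lift P x) (lift P x + Pi.single μ 1) := within_add_single (lift P x) μ zero_le_one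
  constructor
  · by_contra hc
    push Not at hc
    -- `x + e_μ ∈ Ω_{j'} ⊆ Ω_{j+2}` and `x` is within `1 < s_{j+2}` of it, so `x ∈ Ω_{j+1}` — but the level `j < k` of `x` forbids it
    have h2 : x.shift μ ∈ maxDomT M₁ Z (j + 1 + 1) :=
      maxDomT_antitone hM1 Z (by omega) (mem_maxDomT_of_level hM1 hk hdiv (by omega) hj' h')
    have hside : (1 : ℤ) ≤ ((side P.L M₁ (j + 1 + 1) : ℕ) : ℤ) - 1 := by
      have := le_side (P := P) (M₁ := M₁) (j + 1 + 1); omega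
    have hx : x ∈ maxDomT M₁ Z (j + 1) := by
      have e := dist_maxDomT hM1 hdiv (show j + 1 + 1 ≤ k by omega) (x := lift P x + Pi.single μ 1)
        (by rw [cover_lift_add_single]; exact h2) (y := lift P x) (Within.mono hside hw.symm)
      rwa [cover_lift] at e
    exact not_mem_maxDomT_succ_of_level hM1 hk hdiv (by omega) h hx
  · by_contra hc
    push Not at hc
    have h2 : x ∈ maxDomT M₁ Z (j' + 1 + 1) :=
      maxDomT_antitone hM1 Z (by omega) (mem_maxDomT_of_level hM1 hk hdiv (by omega) hj h)
    have hside : (1 : ℤ) ≤ ((side P.L M₁ (j' + 1 + 1) : ℕ) : ℤ) - 1 := by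
      have := le_side (P := P) (M₁ := M₁) (j' + 1 + 1); omega
    have hx : x.shift μ ∈ maxDomT M₁ Z (j' + 1) := by
      have e := dist_maxDomT hM1 hdiv (show j' + 1 + 1 ≤ k by omega) (x := lift P x)
        (by rw [cover_lift]; exact h2) (y := lift P x + Pi.single μ 1) (Within.mono hside hw)
      rwa [cover_lift_add_single] at e
    exact not_mem_maxDomT_succ_of_level hM1 hk hdiv (by omega) h' hx

/-- ★ **EVERY `ℓ`-SITE OF THE OUTER `(ℓ+1)`-BLOCK IS A `Γ_ℓ`-SITE.**  Let `x ∉ Ω_{ℓ+1}(Z)` be a fine site adjacent (in either orientation) to a fine site `z ∈ Ω_{ℓ+1}(Z)` (`ℓ + 1 ≤ k`,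
`M₁ ≥ 2`).  Then every `ℓ`-site `v` of the `(ℓ+1)`-block `w = B^{ℓ+1}(x)` belongs to `Γ_ℓ`: its representative `ι_ℓ v` lies off `Ω_{ℓ+1}` (a union of `(ℓ+1)`-blocks missing `x`), and
inside `Ω_ℓ` for `ℓ ≥ 1` by the printed collar (`ι_ℓ v` is within `L^{ℓ+1} ≤ L^{ℓ+1}M₁ − 1` of `z` on the cover); for `ℓ = 0`, `Γ₀ = Ω₁ᶜ`. [cite: Balaban1988Convergent, (2.2) p.255, (2.13) pp.256–257] -/
theorem mem_Bj_of_blockOf_eq_outerBlock (hM : 2 ≤ M₁) (hk1 : 1 ≤ k) (hk : k ≤ P.m + P.K) (hdiv : side P.L M₁ k ∣ P.sitesPerDir 0)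
    {ℓ : ℕ} (hℓk : ℓ + 1 ≤ k) {x z : Site P 0} {μ : Fin P.d} (hadj : z = x.shift μ ∨ x = z.shift μ)
    (hz : z ∈ maxDomT M₁ Z (ℓ + 1)) (hx : x ∉ maxDomT M₁ Z (ℓ + 1)) {v : Site P ℓ} (hv : blockOf v = blockIter (ℓ + 1) x) :
    v ∈ Bj M₁ Z k ℓ := by
  have hM1 : 1 ≤ M₁ := one_le_of_two_le hM
  -- the `(ℓ+1)`-block of the representative of `v` is the `(ℓ+1)`-block of `x`
  have e1 : blockIter (ℓ + 1) (embIter ℓ v) = blockIter (ℓ + 1) x := by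
    rw [blockIter_succ, blockIter_embIter (by omega) v, hv]
  -- (a) off `Ω_{ℓ+1}`
  have ha : embIter ℓ v ∉ maxDomT M₁ Z (ℓ + 1) := by
    intro hmem
    have hBU := isBlockUnion_maxDomT hM1 hdiv (show 1 ≤ ℓ + 1 by omega) hℓk (show ℓ + 1 ≤ P.m + P.K by omega) (Ω := Z)
    have h1 := (hBU (embIter ℓ v)).1 hmem
    rw [e1] at h1
    exact hx ((hBU x).2 h1)
  rcases Nat.eq_zero_or_pos ℓ with hℓ0 | hℓ1
  · subst hℓ0
    rw [Bj_zero hk1]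
    exact ha
  · rw [Bj_mid hℓ1 (show ℓ < k by omega)]
    refine ⟨mem_pts.2 ?_, fun h => ha (mem_pts.1 h)⟩
    -- (b) inside `Ω_ℓ` by the collar from `z ∈ Ω_{ℓ+1}`
    have hwx : Within (((P.L ^ (ℓ + 1) : ℕ) : ℤ) - 1) (lift P x) (lift P (embIter ℓ v)) :=
      within_lift_of_blockIter_eq (by omega) e1.symm
    have hside : ((P.L ^ (ℓ + 1) : ℕ) : ℤ) ≤ ((side P.L M₁ (ℓ + 1) : ℕ) : ℤ) - 1 := by
      have := pow_succ_le_side (P := P) hM (ℓ + 1); omega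
    rcases hadj with hzx | hxz
    · have hw : Within (((side P.L M₁ (ℓ + 1) : ℕ) : ℤ) - 1) (lift P x + Pi.single μ 1) (lift P (embIter ℓ v)) :=
        Within.mono (by omega) (((within_add_single (lift P x) μ zero_le_one).symm).triangle hwx)
      have e := dist_maxDomT hM1 hdiv hℓk (x := lift P x + Pi.single μ 1) (by rw [cover_lift_add_single, ← hzx]; exact hz) hw
      rwa [cover_lift] at e
    · have hw : Within (((side P.L M₁ (ℓ + 1) : ℕ) : ℤ) - 1) (lift P x - Pi.single μ 1) (lift P (embIter ℓ v)) :=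
        Within.mono (by omega) (((within_sub_single (lift P x) μ zero_le_one).symm).triangle hwx)
      have e := dist_maxDomT hM1 hdiv hℓk (x := lift P x - Pi.single μ 1) (by rw [cover_lift_sub_single hxz]; exact hz) hw
      rwa [cover_lift] at e

/-- ★ **THE `ℓ`-SITES OF THE OUTER `(ℓ+1)`-BLOCK ARE `T`-EQUIVALENT** for every `T` closed under the constrained bonds: two `ℓ`-sites `v, v'` of the block `B^{ℓ+1}(x)` of
`mem_Bj_of_blockOf_eq_outerBlock` have `ι_ℓ v ∈ T ↔ ι_ℓ v' ∈ T` — dag-n12-w3's lattice path INSIDE the block (`exists_blockWalk`) runs through `Γ_ℓ`-sites only, so each of its bonds is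
constrained. [cite: Balaban1988Convergent, (2.2) p.255; Balaban1987RG1, (0.3) p.252 (bookkeeping)] -/
theorem embIter_mem_iff_of_outerBlock (hM : 2 ≤ M₁) (hk1 : 1 ≤ k) (hk : k ≤ P.m + P.K) (hdiv : side P.L M₁ k ∣ P.sitesPerDir 0)
    {ℓ : ℕ} (hℓk : ℓ + 1 ≤ k) {x z : Site P 0} {μ : Fin P.d} (hadj : z = x.shift μ ∨ x = z.shift μ)
    (hz : z ∈ maxDomT M₁ Z (ℓ + 1)) (hx : x ∉ maxDomT M₁ Z (ℓ + 1)) {T : Set (Site P 0)}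
    (hT : ∀ j, j ≤ k → ∀ c ∈ bondsOf (Bj M₁ Z k j), (embIter j c.src ∈ T ↔ embIter j c.tgt ∈ T))
    (v v' : Site P ℓ) (hv : blockOf v = blockIter (ℓ + 1) x) (hv' : blockOf v' = blockIter (ℓ + 1) x) :
    (embIter ℓ v ∈ T ↔ embIter ℓ v' ∈ T) := by
  -- a level-`ℓ` bond sourced in the block is constrained
  have hbond : ∀ c : PBond P ℓ, blockOf c.src = blockIter (ℓ + 1) x → (embIter ℓ c.src ∈ T ↔ embIter ℓ c.tgt ∈ T) := fun c hc =>
    hT ℓ (by omega) c (Or.inl (mem_Bj_of_blockOf_eq_outerBlock hM hk1 hk hdiv hℓk hadj hz hx hc))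
  -- dag-n12-w3's walk inside the block from `v` to `v'`
  obtain ⟨ch, -, hmem, hend, hcons⟩ := exists_blockWalk (show ℓ + 1 ≤ P.m + P.K by omega) _ v v' (hv.trans hv'.symm) rfl
  -- `T`-membership passes along any such walk (induction on the walk, generalising its start)
  have key : ∀ (ch : List (PBond P ℓ × Bool)) (q : Site P ℓ), (∀ l ∈ ch, blockOf l.1.src = blockIter (ℓ + 1) x) →
      (∀ (pre post : List (PBond P ℓ × Bool)) (l : PBond P ℓ × Bool), ch = pre ++ l :: post →
        (l.2 = true → walkEnd q (pre.map fun l => (l.1.dir, l.2)) = l.1.src) ∧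
        (l.2 = false → walkEnd q (pre.map fun l => (l.1.dir, l.2)) = l.1.tgt)) →
      (embIter ℓ q ∈ T ↔ embIter ℓ (walkEnd q (ch.map fun l => (l.1.dir, l.2))) ∈ T) := by
    intro ch
    induction ch with
    | nil => intro q _ _; exact Iff.rfl
    | cons l₀ ch ih =>
      intro q hblk hread
      obtain ⟨b, s⟩ := l₀
      have h0 := hread [] ch (b, s) rfl
      have hb : embIter ℓ b.src ∈ T ↔ embIter ℓ b.tgt ∈ T := hbond b (hblk (b, s) (List.mem_cons_self))
      -- the tail, read from the site after the first step
      have htail : ∀ q₁ : Site P ℓ, (∀ rest, walkEnd q ((b.dir, s) :: rest) = walkEnd q₁ rest) →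
          (embIter ℓ q₁ ∈ T ↔ embIter ℓ (walkEnd q (((b, s) :: ch).map fun l => (l.1.dir, l.2))) ∈ T) := by
        intro q₁ hq₁
        rw [List.map_cons, hq₁]
        refine ih q₁ (fun l hl => hblk l (List.mem_cons_of_mem _ hl)) (fun pre post l hch => ?_)
        have h := hread ((b, s) :: pre) post l (by rw [hch]; rfl)
        rw [List.map_cons, hq₁] at h
        exact h
      cases s
      · -- backward step: `q = b₊`, next site `b₋`
        have hq : q = b.tgt := h0.2 rfl
        have hnext : ∀ rest, walkEnd q ((b.dir, false) :: rest) = walkEnd b.src rest := fun rest => by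
          rw [hq]; show walkEnd ((b.src.shift b.dir).unshift b.dir) rest = _; rw [B10StarCount.unshift_shift]
        rw [← htail b.src hnext, hq]
        exact hb.symm
      · -- forward step: `q = b₋`, next site `b₊`
        have hq : q = b.src := h0.1 rfl
        have hnext : ∀ rest, walkEnd q ((b.dir, true) :: rest) = walkEnd b.tgt rest := fun rest => by rw [hq]; rfl
        rw [← htail b.tgt hnext, hq]
        exact hb
  have h := key ch v (fun l hl => (hmem l hl).1.trans hv') hcons
  rw [hend] at h
  exact h

end Summit.QuantumFields.YangMills.BalabanUVNodes.N12TowerSiteGraphConnectedBjPrelim
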